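import Literature.Geometry.Kaehler.PluriharmonicLog
import Mathlib.Geometry.Manifold.ContMDiffMFDeriv
import Mathlib.Topology.Compactness.Compact
import Mathlib.Analysis.InnerProductSpace.PiL2
import Mathlib.Analysis.SpecialFunctions.Pow.Real
import HarnessLib

/-!
# Continuity tools for transporting tangent data along a family of maps

Topic `Literature/Geometry/Kaehler`. Three auxiliary results used to feed the soft upper
semicontinuity theorem for Hodge numbers (`Motives/HodgeNumberUpperSemicontinuous`) with its
"almost isometric, almost holomorphic" hypotheses, for the fibres of a `C^∞`-trivialised family
of compact complex submanifolds of a Kähler manifold (Voisin (2002), §9.1.1 Thm. 9.3 / Prop. 9.5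
and §9.3.2 Prop. 9.20):

* `eventually_abs_sum_mul_mul_le_mul_sqrt` — **uniform smallness of a continuous family of
  bilinear defects measured in a continuous positive definite Gram family** over a compact space
  (a tube-lemma argument, `IsCompact.eventually_forall_of_forall_eventually`, plus the uniform
  lower bound `cᵀ Γ(x) c ≥ λ ‖c‖²` on `K ×` unit sphere);
* `ContMDiffAt.tangentJ_bundle` — **the almost complex structure `J` of a complex manifold is a
  smooth bundle map** of the real tangent bundle (its coordinate expression in any tangent
  trivialization is `i • ·`, the tangent coordinate changes of a holomorphic atlas being
  `ℂ`-linear, Voisin (2002), §2.2.1);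
* `contMDiffAt_mfderiv_apply_section` — **the partial derivative of a parametrised family of maps
  applied to a vector field is a smooth map into the tangent bundle** (Mathlib's
  `ContMDiffAt.mfderiv_apply`, translated back from tangent coordinates).

## References

* C. Voisin, *Hodge Theory and Complex Algebraic Geometry I*, CUP 2002, §2.2.1, §9.1.1, §9.3.2.
  [cite: VoisinHodgeI2002, §2.2.1]
* J. M. Lee, *Introduction to Smooth Manifolds*, 2nd ed., Springer 2013, Ch. 3 (tangent bundle).
-/

noncomputable section

open scoped Manifold ContDiff Topology
open Bundle Set Filter Function

namespace Literature.Geometry.Kaehler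

/-- **Uniform smallness of a continuous family of bilinear defects, measured in a continuous
positive definite Gram family.** Let `K` be compact, `P` a topological space, `p₀ ∈ P`, and let
`Θ p x` (`p ∈ P`, `x ∈ K`) be `n × n` real matrices depending continuously on `(p, x)` with
`Θ p₀ x = 0`, and `Γ x` positive definite matrices depending continuously on `x`. Then for every
`ε > 0`, for all `p` near `p₀`, `|cᵀ Θ(p, x) d| ≤ ε ‖c‖_{Γ x} ‖d‖_{Γ x}` for all `x ∈ K` and all
coefficient vectors `c, d` (where `‖c‖²_{Γ x} = cᵀ Γ(x) c`): the entries of `Θ` tend to `0`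
uniformly on `K` (compactness, `IsCompact.eventually_forall_of_forall_eventually`) and `cᵀ Γ(x) c ≥ λ ‖c‖²` for a `λ > 0`
independent of `x` (minimum over `K ×` the unit sphere). [folklore] -/
theorem eventually_abs_sum_mul_mul_le_mul_sqrt
    {P : Type*} [TopologicalSpace P] {K : Type*} [TopologicalSpace K]
    [CompactSpace K] {n : ℕ} {p₀ : P} (Θ : P → K → Fin n → Fin n → ℝ) (Γ : K → Fin n → Fin n → ℝ)
    (hΘ : ∀ j l, Continuous fun q : P × K ↦ Θ q.1 q.2 j l) (hΘ0 : ∀ x j l, Θ p₀ x j l = 0)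
    (hΓ : ∀ j l, Continuous fun x ↦ Γ x j l)
    (hΓpos : ∀ (x : K) (c : Fin n → ℝ), c ≠ 0 → 0 < ∑ j, ∑ l, c j * c l * Γ x j l)
    {ε : ℝ} (hε : 0 < ε) :
    ∀ᶠ p in 𝓝 p₀, ∀ (x : K) (c d : Fin n → ℝ),
      |∑ j, ∑ l, c j * d l * Θ p x j l| ≤
        ε * Real.sqrt (∑ j, ∑ l, c j * c l * Γ x j l) * Real.sqrt (∑ j, ∑ l, d j * d l * Γ x j l) := by
  classical
  rcases isEmpty_or_nonempty K with hK | hK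
  · exact Eventually.of_forall fun p x ↦ (IsEmpty.false x).elim
  rcases Nat.eq_zero_or_pos n with hn | hn
  · subst hn
    exact Eventually.of_forall fun p x c d ↦ by simp
  -- the Gram quadratic form and its uniform lower bound `λ ‖c‖² ≤ G x c`
  set G : K → (Fin n → ℝ) → ℝ := fun x c ↦ ∑ j, ∑ l, c j * c l * Γ x j l with hG
  have hGcont : Continuous fun q : K × (Fin n → ℝ) ↦ G q.1 q.2 := by
    simp only [hG]
    refine continuous_finsetSum _ fun j _ ↦ continuous_finsetSum _ fun l _ ↦ ?_
    exact (((continuous_apply j).comp continuous_snd).mul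
      ((continuous_apply l).comp continuous_snd)).mul ((hΓ j l).comp continuous_fst)
  have hGsmul : ∀ x (t : ℝ) c, G x (t • c) = t ^ 2 * G x c := by
    intro x t c
    simp only [hG, Pi.smul_apply, smul_eq_mul, Finset.mul_sum]
    exact Finset.sum_congr rfl fun j _ ↦ Finset.sum_congr rfl fun l _ ↦ by ring
  obtain ⟨lam, hlam, hlamG⟩ : ∃ lam : ℝ, 0 < lam ∧ ∀ x c, lam * ‖c‖ ^ 2 ≤ G x c := by
    have hS : IsCompact ((univ : Set K) ×ˢ Metric.sphere (0 : Fin n → ℝ) 1) :=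
      isCompact_univ.prod (isCompact_sphere 0 1)
    haveI : Nonempty (Fin n) := ⟨⟨0, hn⟩⟩
    have hc₁ : (fun _ : Fin n ↦ (1 : ℝ)) ∈ Metric.sphere (0 : Fin n → ℝ) 1 := by
      rw [mem_sphere_zero_iff_norm]
      refine le_antisymm ((pi_norm_le_iff_of_nonneg zero_le_one).2 fun _ ↦ by simp) ?_
      have h := norm_le_pi_norm (fun _ : Fin n ↦ (1 : ℝ)) ⟨0, hn⟩
      rwa [norm_one] at h
    set c₁ : Fin n → ℝ := fun _ ↦ 1
    have hSne : ((univ : Set K) ×ˢ Metric.sphere (0 : Fin n → ℝ) 1).Nonempty :=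
      ⟨(Classical.arbitrary K, c₁), mem_univ _, hc₁⟩
    obtain ⟨⟨x₁, c₂⟩, hmem, hmin⟩ := hS.exists_isMinOn hSne hGcont.continuousOn
    have hc₂ : ‖c₂‖ = 1 := by simpa using hmem
    have hc₂0 : c₂ ≠ 0 := by
      rintro rfl
      simp at hc₂
    refine ⟨G x₁ c₂, hΓpos x₁ c₂ hc₂0, fun x c ↦ ?_⟩
    by_cases hc : c = 0
    · subst hc
      simp [hG]
    · have hcn : 0 < ‖c‖ := norm_pos_iff.2 hc
      have hmem' : (x, ‖c‖⁻¹ • c) ∈ (univ : Set K) ×ˢ Metric.sphere (0 : Fin n → ℝ) 1 := by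
        refine ⟨mem_univ _, ?_⟩
        rw [mem_sphere_zero_iff_norm, norm_smul, norm_inv, norm_norm, inv_mul_cancel₀ hcn.ne']
      have h1 : G x₁ c₂ ≤ G x (‖c‖⁻¹ • c) := hmin hmem'
      rw [hGsmul, inv_pow] at h1
      have h2 : G x₁ c₂ * ‖c‖ ^ 2 ≤ (‖c‖ ^ 2)⁻¹ * G x c * ‖c‖ ^ 2 :=
        mul_le_mul_of_nonneg_right h1 (by positivity)
      rwa [mul_comm ((‖c‖ ^ 2)⁻¹), mul_assoc, inv_mul_cancel₀ (by positivity), mul_one] at h2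
  -- entries of `Θ` are uniformly small near `p₀`
  have hunif : ∀ j l, ∀ η : ℝ, 0 < η → ∀ᶠ p in 𝓝 p₀, ∀ x, |Θ p x j l| < η := by
    intro j l η hη
    have key := (isCompact_univ (X := K)).eventually_forall_of_forall_eventually (x₀ := p₀)
      (P := fun p x ↦ |Θ p x j l| < η) (fun x _ ↦ ?_)
    · exact key.mono fun p hp x ↦ hp x (mem_univ x)
    · have hc : ContinuousAt (fun q : P × K ↦ |Θ q.1 q.2 j l|) (p₀, x) :=
        ((hΘ j l).continuousAt).abs
      have h0 : |Θ p₀ x j l| < η := by rw [hΘ0]; simpa using hη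
      exact hc.eventually_lt continuousAt_const h0
  set η : ℝ := ε * lam / ((n : ℝ) ^ 2) with hηdef
  have hη : 0 < η := by positivity
  have hall : ∀ᶠ p in 𝓝 p₀, ∀ j l x, |Θ p x j l| < η := by
    rw [eventually_all]
    intro j
    rw [eventually_all]
    intro l
    exact hunif j l η hη
  filter_upwards [hall] with p hp x c d
  -- the estimate
  have hnorm : ∀ c : Fin n → ℝ, ‖c‖ ≤ Real.sqrt (G x c) / Real.sqrt lam := by
    intro c
    rw [le_div_iff₀ (Real.sqrt_pos.2 hlam), ← Real.sqrt_sq (norm_nonneg c), ← Real.sqrt_mul (sq_nonneg _)]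
    exact Real.sqrt_le_sqrt (by rw [mul_comm]; exact hlamG x c)
  have hsumabs : ∀ c : Fin n → ℝ, ∑ j, |c j| ≤ n * ‖c‖ := by
    intro c
    have : ∀ j ∈ Finset.univ, |c j| ≤ ‖c‖ := fun j _ ↦ by
      rw [← Real.norm_eq_abs]; exact norm_le_pi_norm c j
    have h := Finset.sum_le_card_nsmul _ _ _ this
    simpa using h
  have h1 : |∑ j, ∑ l, c j * d l * Θ p x j l| ≤ ∑ j, ∑ l, |c j| * |d l| * η := by
    refine (Finset.abs_sum_le_sum_abs _ _).trans (Finset.sum_le_sum fun j _ ↦ ?_)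
    refine (Finset.abs_sum_le_sum_abs _ _).trans (Finset.sum_le_sum fun l _ ↦ ?_)
    rw [abs_mul, abs_mul]
    exact mul_le_mul_of_nonneg_left (hp j l x).le (by positivity)
  have h2 : ∑ j, ∑ l, |c j| * |d l| * η = η * (∑ j, |c j|) * (∑ l, |d l|) := by
    rw [mul_assoc, Finset.sum_mul_sum, Finset.mul_sum]
    refine Finset.sum_congr rfl fun j _ ↦ ?_
    rw [Finset.mul_sum]
    exact Finset.sum_congr rfl fun l _ ↦ by ring
  have hGc : 0 ≤ Real.sqrt (G x c) := Real.sqrt_nonneg _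
  have hGd : 0 ≤ Real.sqrt (G x d) := Real.sqrt_nonneg _
  have h3 : η * (∑ j, |c j|) * (∑ l, |d l|) ≤ η * (n * ‖c‖) * (n * ‖d‖) := by
    have := hsumabs c
    have := hsumabs d
    gcongr
  have h4 : η * (n * ‖c‖) * (n * ‖d‖) ≤
      η * (n * (Real.sqrt (G x c) / Real.sqrt lam)) * (n * (Real.sqrt (G x d) / Real.sqrt lam)) := by
    have := hnorm c
    have := hnorm d
    gcongr
  have h5 : η * (n * (Real.sqrt (G x c) / Real.sqrt lam)) * (n * (Real.sqrt (G x d) / Real.sqrt lam)) =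
      ε * Real.sqrt (G x c) * Real.sqrt (G x d) := by
    have hsl : Real.sqrt lam * Real.sqrt lam = lam := Real.mul_self_sqrt hlam.le
    have hn0 : (n : ℝ) ≠ 0 := by exact_mod_cast hn.ne'
    have hsl0 : Real.sqrt lam ≠ 0 := (Real.sqrt_pos.2 hlam).ne'
    have hsq : Real.sqrt lam ^ 2 = lam := Real.sq_sqrt hlam.le
    rw [hηdef]
    rw [show ε * lam / (n : ℝ) ^ 2 * ((n : ℝ) * (Real.sqrt (G x c) / Real.sqrt lam)) *
        ((n : ℝ) * (Real.sqrt (G x d) / Real.sqrt lam)) =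
        ε * (Real.sqrt (G x c) * Real.sqrt (G x d)) * ((n : ℝ) ^ 2 / (n : ℝ) ^ 2) *
          (lam / Real.sqrt lam ^ 2) by ring]
    rw [hsq, div_self (pow_ne_zero 2 hn0), div_self hlam.ne']
    ring
  calc |∑ j, ∑ l, c j * d l * Θ p x j l| ≤ ∑ j, ∑ l, |c j| * |d l| * η := h1
    _ = η * (∑ j, |c j|) * (∑ l, |d l|) := h2
    _ ≤ η * (n * ‖c‖) * (n * ‖d‖) := h3
    _ ≤ η * (n * (Real.sqrt (G x c) / Real.sqrt lam)) * (n * (Real.sqrt (G x d) / Real.sqrt lam)) := h4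
    _ = ε * Real.sqrt (G x c) * Real.sqrt (G x d) := h5

section TrivSnd

variable {𝕜 : Type*} [NontriviallyNormedField 𝕜] {E : Type*} [NormedAddCommGroup E] [NormedSpace 𝕜 E]
  {H : Type*} [TopologicalSpace H] {I : ModelWithCorners 𝕜 E H}
  {M : Type*} [TopologicalSpace M] [ChartedSpace H M] [IsManifold I 1 M]

/-- The fibre coordinate of the tangent bundle trivialization at `y₀` is the tangent coordinate
change to the chart at `y₀` (definitional). [folklore] -/
theorem trivializationAt_tangentSpace_snd (y₀ : M) (z : TangentBundle I M) :
    (trivializationAt E (TangentSpace I) y₀ z).2 = tangentCoordChange I z.proj y₀ z.proj z.2 :=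
  rfl

end TrivSnd

section J

variable {E : Type*} [NormedAddCommGroup E] [NormedSpace ℂ E]
  {M : Type*} [TopologicalSpace M] [ChartedSpace E M] [IsManifold 𝓘(ℝ, E) ∞ M]
  [IsManifold 𝓘(ℂ, E) ω M]
  {EP : Type*} [NormedAddCommGroup EP] [NormedSpace ℝ EP] {HP : Type*} [TopologicalSpace HP]
  {IP : ModelWithCorners ℝ EP HP} {P : Type*} [TopologicalSpace P] [ChartedSpace HP P]

/-- **`J` is a smooth bundle map of the real tangent bundle of a complex manifold**: if
`A : P → TM` is `C^n` at `p₀` then so is `p ↦ J (A p)` (same base point). In the trivialization at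
the base point of `A p₀` the fibre coordinate of `J (A p)` is `i •` that of `A p`, because the
tangent coordinate changes of a holomorphic atlas are `ℂ`-linear (`tangentCoordChange_I_smul`).
Voisin (2002), §2.2.1. [cite: VoisinHodgeI2002, §2.2.1] -/
theorem ContMDiffAt.tangentJ_bundle {n : ℕ∞ω} {A : P → TangentBundle 𝓘(ℝ, E) M} {p₀ : P}
    (hA : ContMDiffAt IP 𝓘(ℝ, E).tangent n A p₀) :
    ContMDiffAt IP 𝓘(ℝ, E).tangent n
      (fun p ↦ (⟨(A p).proj, tangentJ E (A p).proj (A p).2⟩ : TangentBundle 𝓘(ℝ, E) M)) p₀ := by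
  rw [contMDiffAt_totalSpace] at hA ⊢
  refine ⟨hA.1, ?_⟩
  -- the fibre coordinate is `i •` that of `A`, near `p₀`
  have hev : ∀ᶠ p in 𝓝 p₀, (A p).proj ∈ (chartAt E (A p₀).proj).source :=
    hA.1.continuousAt.preimage_mem_nhds ((chartAt E (A p₀).proj).open_source.mem_nhds
      (mem_chart_source E _))
  have heq : (fun p ↦ (trivializationAt E (TangentSpace 𝓘(ℝ, E)) (A p₀).proj
      (⟨(A p).proj, tangentJ E (A p).proj (A p).2⟩ : TangentBundle 𝓘(ℝ, E) M)).2) =ᶠ[𝓝 p₀]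
      fun p ↦ ((Complex.I • ContinuousLinearMap.id ℂ E).restrictScalars ℝ)
        ((trivializationAt E (TangentSpace 𝓘(ℝ, E)) (A p₀).proj (A p)).2) := by
    filter_upwards [hev] with p hp
    simp only [trivializationAt_tangentSpace_snd]
    have hmem : (A p).proj ∈ (extChartAt 𝓘(ℝ, E) (A p).proj).source ∩
        (extChartAt 𝓘(ℝ, E) (A p₀).proj).source := by
      simp only [extChartAt_source]
      exact ⟨mem_chart_source E _, hp⟩
    exact tangentCoordChange_I_smul hmem _
  refine (ContMDiffAt.comp p₀ ?_ hA.2).congr_of_eventuallyEq heq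
  exact ((Complex.I • ContinuousLinearMap.id ℂ E).restrictScalars ℝ).contDiff.contMDiff.contMDiffAt

end J

section MFDerivSection

variable {E : Type*} [NormedAddCommGroup E] [NormedSpace ℝ E] {H : Type*} [TopologicalSpace H]
  {I : ModelWithCorners ℝ E H} {M : Type*} [TopologicalSpace M] [ChartedSpace H M]
  {E' : Type*} [NormedAddCommGroup E'] [NormedSpace ℝ E'] {H' : Type*} [TopologicalSpace H']
  {I' : ModelWithCorners ℝ E' H'} {M' : Type*} [TopologicalSpace M'] [ChartedSpace H' M']
  {EP : Type*} [NormedAddCommGroup EP] [NormedSpace ℝ EP] {HP : Type*} [TopologicalSpace HP]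
  {IP : ModelWithCorners ℝ EP HP} {P : Type*} [TopologicalSpace P] [ChartedSpace HP P]
  {m n : ℕ∞ω} [IsManifold I 1 M] [IsManifold I' 1 M'] [IsManifold IP 1 P]

/-- **The partial derivative of a parametrised family of maps, applied to a vector field, is a
smooth map into the tangent bundle.** If `f : P → M → M'` is `C^n` jointly near `(p₀, g p₀)`,
`g : P → M` is `C^m`, and `X` is a `C^m` vector field near `g p₀` (`m + 1 ≤ n`), then
`p ↦ (f p (g p), D(f p)_{g p} (X (g p))) ∈ TM'` is `C^m` at `p₀`. This is Mathlib's
`ContMDiffAt.mfderiv_apply` (derivative read in tangent coordinates) translated back to the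
tangent bundle by `contMDiffAt_totalSpace`. [folklore] -/
theorem contMDiffAt_mfderiv_apply_section (f : P → M → M') (g : P → M)
    (X : ∀ x : M, TangentSpace I x) {p₀ : P}
    (hf : ContMDiffAt (IP.prod I) I' n (uncurry f) (p₀, g p₀)) (hg : ContMDiffAt IP I m g p₀)
    (hX : ContMDiffAt I I.tangent m (fun x ↦ (⟨x, X x⟩ : TangentBundle I M)) (g p₀))
    (hmn : m + 1 ≤ n) :
    ContMDiffAt IP I'.tangent m (fun p ↦
      (⟨f p (g p), mfderiv I I' (f p) (g p) (X (g p))⟩ : TangentBundle I' M')) p₀ := by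
  rw [contMDiffAt_totalSpace]
  have hbase : ContMDiffAt IP I' m (fun p ↦ f p (g p)) p₀ :=
    (hf.of_le (le_trans le_self_add hmn)).comp p₀ (contMDiffAt_id.prodMk hg)
  refine ⟨hbase, ?_⟩
  -- the coordinates of `X (g p)` in the trivialization at `g p₀`
  set g₂ : P → E := fun p ↦ (trivializationAt E (TangentSpace I) (g p₀)
    (⟨g p, X (g p)⟩ : TangentBundle I M)).2 with hg₂
  have hX' := (contMDiffAt_totalSpace.1 hX).2
  have hg₂s : ContMDiffAt IP 𝓘(ℝ, E) m g₂ p₀ := hX'.comp p₀ hg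
  have key := ContMDiffAt.mfderiv_apply f g id g₂ (x₀ := p₀) hf hg contMDiffAt_id hg₂s hmn
  -- compare with the fibre coordinate of our map, near `p₀`
  have hev₁ : ∀ᶠ p in 𝓝 p₀, g p ∈ (chartAt H (g p₀)).source :=
    hg.continuousAt.preimage_mem_nhds ((chartAt H (g p₀)).open_source.mem_nhds
      (mem_chart_source H _))
  have hev₂ : ∀ᶠ p in 𝓝 p₀, f p (g p) ∈ (chartAt H' (f p₀ (g p₀))).source :=
    hbase.continuousAt.preimage_mem_nhds ((chartAt H' (f p₀ (g p₀))).open_source.mem_nhds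
      (mem_chart_source H' _))
  have heq : (fun p ↦ inTangentCoordinates I I' g (fun p ↦ f p (g p))
      (fun p ↦ mfderiv I I' (f p) (g p)) (id p₀) (id p) (g₂ p)) =ᶠ[𝓝 p₀]
      fun p ↦ (trivializationAt E' (TangentSpace I') (f p₀ (g p₀))
        (⟨f p (g p), mfderiv I I' (f p) (g p) (X (g p))⟩ : TangentBundle I' M')).2 := by
    filter_upwards [hev₁, hev₂] with p hp₁ hp₂
    simp only [id]
    rw [inTangentCoordinates_eq _ _ _ hp₁ hp₂, trivializationAt_tangentSpace_snd]
    simp only [ContinuousLinearMap.comp_apply, hg₂, trivializationAt_tangentSpace_snd]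
    -- `coordChange (g p₀ → g p) ∘ coordChange (g p → g p₀) = id` on the fibre at `g p`
    have hcomp : (tangentBundleCore I M).coordChange (achart H (g p₀)) (achart H (g p)) (g p)
        (tangentCoordChange I (g p) (g p₀) (g p) (X (g p))) = X (g p) := by
      change tangentCoordChange I (g p₀) (g p) (g p)
        (tangentCoordChange I (g p) (g p₀) (g p) (X (g p))) = X (g p)
      rw [tangentCoordChange_comp, tangentCoordChange_self]
      · simp only [extChartAt_source]; exact mem_chart_source H _
      · simp only [extChartAt_source]
        exact ⟨⟨mem_chart_source H _, hp₁⟩, mem_chart_source H _⟩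
    rw [hcomp]
    rfl
  exact key.congr_of_eventuallyEq heq.symm

end MFDerivSection

end Literature.Geometry.Kaehler
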